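import Literature.Geometry.Kaehler.ComplexTorusChainPeriodicStokes
import HarnessLib

/-!
# The fundamental weight of a period lattice: sign and compact support

Layer `Literature/Geometry/Kaehler`, namespace `Literature.Geometry.Kaehler.ComplexTorus`; lane
`lit-hodgefound`, prover seat `lit-hodgefound-p07`, generation 19 — riders on the fundamental weight
`w_K = Π_{k ∈ K} ψ(x_k)` of `ComplexTorusChainPeriodicStokes.lean` (Federer 4.1.7: a smooth
partition of unity for the lattice translations, `Σ_{λ ∈ Λ_K} w_K(x + λ) = 1`) needed to use
`w = w_univ` as the TEST FUNCTION `g` of the Crofton–Jensen inequality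
(`HolomorphicChainCroftonJensen.lean`: `g ∈ C²_c`, `g ≥ 0`) in the torus glue of the programme
«`[Θ_Ω] = -E_Ω` for every `Ω ∈ 𝔥_g`»:

* `weight_nonneg`, `weight_le_one` — `0 ≤ w_K ≤ 1`;
* `tsupport_weight_subset` — `spt w_K ⊆ {x | x_k ∈ [0, 2], k ∈ K}`;
* `hasCompactSupport_weight_univ` — for `K = univ` (the full lattice, `ι` finite) the weight is
  compactly supported: its support lies in the image of the cube `[0, 2]^ι` under the period map.

Theorems only; no definitions, no named facts.

## References

* [Federer1969] H. Federer, *Geometric Measure Theory*, Springer (1969), 4.1.7.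
-/

noncomputable section

open Set Function

namespace Literature.Geometry.Kaehler

namespace ComplexTorus

variable {ι : Type*} {E : Type*} [NormedAddCommGroup E] [NormedSpace ℂ E]
  (Φ : (ι → ℝ) ≃L[ℝ] E) (K : Finset ι)

/-- `0 ≤ w_K`. [cite: Federer1969, 4.1.7] -/
theorem weight_nonneg (x : E) : 0 ≤ weight Φ K x :=
  Finset.prod_nonneg fun _ _ => unitPartition_nonneg _

/-- `w_K ≤ 1`. [cite: Federer1969, 4.1.7] -/
theorem weight_le_one (x : E) : weight Φ K x ≤ 1 :=
  (le_abs_self _).trans (abs_weight_le_one Φ K x)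

/-- The (topological) support of `w_K` lies in the closed slab `{x | x_k ∈ [0, 2], k ∈ K}`.
[cite: Federer1969, 4.1.7] -/
theorem tsupport_weight_subset :
    tsupport (weight Φ K) ⊆ {x : E | ∀ k ∈ K, Φ.symm x k ∈ Icc (0 : ℝ) 2} := by
  have hcl : IsClosed {x : E | ∀ k ∈ K, Φ.symm x k ∈ Icc (0 : ℝ) 2} := by
    have : {x : E | ∀ k ∈ K, Φ.symm x k ∈ Icc (0 : ℝ) 2} =
        ⋂ k ∈ K, (fun x : E => Φ.symm x k) ⁻¹' Icc (0 : ℝ) 2 := by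
      ext x; simp
    rw [this]
    exact isClosed_biInter fun k _ =>
      isClosed_Icc.preimage ((continuous_apply k).comp Φ.symm.continuous)
  refine closure_minimal (fun x hx => ?_) hcl
  intro k hk
  exact Ioo_subset_Icc_self (mem_Ioo_of_weight_ne_zero Φ K (mem_support.1 hx) hk)

/-- **For the full lattice the fundamental weight is compactly supported**: `spt w ⊆ Φ([0, 2]^ι)`.
[cite: Federer1969, 4.1.7] -/
theorem hasCompactSupport_weight_univ [Fintype ι] : HasCompactSupport (weight Φ Finset.univ) := by
  have hK : IsCompact (Φ '' Set.pi Set.univ fun _ : ι => Icc (0 : ℝ) 2) :=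
    (isCompact_univ_pi fun _ => isCompact_Icc).image Φ.continuous
  refine IsCompact.of_isClosed_subset hK (isClosed_tsupport _) ?_
  intro x hx
  refine ⟨Φ.symm x, ?_, Φ.apply_symm_apply x⟩
  simp only [Set.mem_pi, Set.mem_univ, forall_true_left]
  exact fun k => tsupport_weight_subset Φ Finset.univ hx k (Finset.mem_univ k)

end ComplexTorus

end Literature.Geometry.Kaehler
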